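import Summits.NavierStokesRegularity.NavierStokesRegularity.Theorems.TypeIQuarterGateQuarterLawTypeILerayLqClass
import HarnessLib

/-!
# `TypeIQuarterGate.QuarterLawTypeI` (crux stmt-NavierStokesRegularity-23726) on Leray's scale of
# blow-up rates: along a Type-I blow-up, saturation at ANY finite `q ≥ 3` ⟺ the quarter law

Helper file (`--supports stmt-NavierStokesRegularity-23726`, def-free), companion of
`TypeIQuarterGateQuarterLawTypeILerayLqClass` (weak-`L^q` Leray rate for one finite `q` ⟹ the quarter law,
Chebyshev + Lamb slaving). Here the CONVERSE along Leray's scale: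

* `eWeakLpPow_le_of_norm_le_of_weakL3` (pure measure theory): a sup bound `‖v‖ ≤ B` and a weak-`L³`
  bound `sup_λ λ³|{λ<‖v‖}| ≤ M'` give `sup_λ λ^q|{λ<‖v‖}| ≤ B^{q−3} M'` for every real `q ≥ 3`.
* `weakLqRate_eventually_of_lorentzBound`, `weakLqRate_of_lorentzBound`: along a classical Leray–Hopf
  solution from a rapidly decaying datum with the sup-norm Type-I rate at `T`, the uniform weak-`L³`
  bound (conclusion of `LorentzUpgradeTypeI`, stmt-24108 = open stub `stub_lorentzUpgrade`) gives the
  weak-`L^q` Leray rate `sup_λ λ^q|{λ<‖u(s)‖}| ≤ A (T−s)^{(3−q)/2}` for EVERY `q ≥ 3` — first near `T`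
  (interpolation with the Type-I ceiling `C/√(T−s)`), then on all of `[0,T)` (Tao's class on `[0,t₀]`:
  `RungReynoldsOne.stub_taoCover` + Sobolev imbedding, as in `LorentzOfEnvelope.lorentzBound_of_eventually`).
* `weakLqRate_iff_lorentzBound`, `weakLqRate_iff_quarterLaw`: per Type-I blow-up and for each fixed
  `q ∈ [3,∞)`, «weak-`L^q` Leray rate on `[0,T)`» ⟺ «uniform weak-`L³` bound» ⟺ «quarter law».
* BY NAME: `quarterLawTypeI_iff_weakLqRateTypeI`, `lorentzUpgradeTypeI_iff_weakLqRateTypeI` — for every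
  `q ∈ [3,∞)` the crux `QuarterLawTypeI` (≡ `LorentzUpgradeTypeI`) is EQUIVALENT to «every Type-I blow-up
  of the class saturates Leray's weak-`L^q` rate».
* §5 (eventual forms): `weakLqRate_of_eventually` / `weakLqRate_iff_eventually` — the rate near `T`
  suffices (Tao's class on `[0,t₀]`); by name `quarterLawTypeI_of_eventualWeakLqRate`,
  `lorentzUpgradeTypeI_of_eventualWeakLqRate`.

READING. `IsTypeIBlowup` is saturation of Leray's 1934 rate at `q = ∞`; the crux asks whether saturation
PROPAGATES DOWN Leray's scale from `q = ∞` to some — equivalently (this file) every — finite `q ≥ 3`.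
All finite rungs `q ∈ [3,∞)` are one and the same statement along a Type-I blow-up; only the passage
`∞ ↝ finite` is open (Wang–Zhang, J. Anal. Math. 123 (2014), Thm 5.3: finitely many singular points for
`3 < p < ∞`, endpoint `p = ∞` not covered).

HONEST FRAMING: equivalences between OPEN statements about a HYPOTHETICAL Type-I blow-up; no stub is
closed; nothing about Navier–Stokes regularity or blow-up is claimed. [cite: Leray1934, §21 (3.15)–(3.16)]
[folklore]
-/

-- the problem directory repeats the summit name (`NavierStokesRegularity/NavierStokesRegularity`)
set_option linter.dupNamespace false

noncomputable section

open Set Filter MeasureTheory Topology Metric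
open scoped ENNReal NNReal

namespace Summit.NavierStokesRegularity.NavierStokesRegularity.Theorems

namespace LerayLqClass

open Literature.Analysis.FluidPDE Literature.Analysis.FunctionSpaces
open Summit.NavierStokesRegularity.NavierStokesRegularity.Theses.TypeIQuarterGate

variable {ν T : ℝ} {u : ℝ → EuclideanSpace ℝ (Fin 3) → EuclideanSpace ℝ (Fin 3)}
  {p : ℝ → EuclideanSpace ℝ (Fin 3) → ℝ}

/-! ### 1. Interpolation between the sup and weak-`L³` (no Navier–Stokes input) -/

/-- **Sup bound + weak-`L³` bound ⟹ weak-`L^q` bound, `q ≥ 3`:** if `‖v‖ ≤ B` pointwise (`B > 0`) and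
`sup_λ λ³|{λ<‖v‖}| ≤ M'`, then `sup_λ λ^q|{λ<‖v‖}| ≤ B^{q−3} M'` (levels `λ ≥ B` are empty; below,
`λ^q = λ^{q−3}λ³ ≤ B^{q−3}λ³`). [folklore] -/
theorem eWeakLpPow_le_of_norm_le_of_weakL3
    {v : EuclideanSpace ℝ (Fin 3) → EuclideanSpace ℝ (Fin 3)} {B M' q : ℝ} (hB0 : 0 < B)
    (hB : ∀ x, ‖v x‖ ≤ B) (hM : eWeakLpPow v 3 volume ≤ ENNReal.ofReal M') (hq : 3 ≤ q) :
    eWeakLpPow v (ENNReal.ofReal q) volume ≤ ENNReal.ofReal (B ^ (q - 3) * M') := by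
  have hq0 : 0 < q := by linarith
  have hp : 0 < (ENNReal.ofReal q).toReal := by rwa [ENNReal.toReal_ofReal hq0.le]
  refine Wu2026Salvage.eWeakLpPow_le_of_forall hp fun σ hσ => ?_
  rw [ENNReal.toReal_ofReal hq0.le]
  rcases le_or_gt B σ with hhigh | hlow
  · -- empty superlevel set
    have hempty : {x | σ < ‖v x‖} = ∅ :=
      eq_empty_of_forall_notMem fun x hx => absurd (lt_of_lt_of_le hx (hB x)) (not_lt.2 hhigh)
    rw [hempty, measure_empty, mul_zero]
    exact zero_le
  · have h3 := ofReal_rpow_mul_meas_lt_le_eWeakLpPow v 3 volume hσ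
    have e3 : (3 : ℝ≥0∞).toReal = (3 : ℝ) := by norm_num
    rw [e3] at h3
    have hsplit : σ ^ q = σ ^ (q - 3) * σ ^ (3 : ℝ) := by
      rw [← Real.rpow_add hσ]; ring_nf
    calc ENNReal.ofReal (σ ^ q) * volume {x | σ < ‖v x‖}
        = ENNReal.ofReal (σ ^ (q - 3)) * (ENNReal.ofReal (σ ^ (3 : ℝ)) * volume {x | σ < ‖v x‖}) := by
          rw [hsplit, ENNReal.ofReal_mul (Real.rpow_nonneg hσ.le _), mul_assoc]
      _ ≤ ENNReal.ofReal (B ^ (q - 3)) * ENNReal.ofReal M' :=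
          mul_le_mul' (ENNReal.ofReal_le_ofReal
            (Real.rpow_le_rpow hσ.le hlow.le (sub_nonneg.2 hq))) (h3.trans hM)
      _ = ENNReal.ofReal (B ^ (q - 3) * M') := (ENNReal.ofReal_mul (Real.rpow_nonneg hB0.le _)).symm

/-- Power bookkeeping: `(B/√τ)^{q−3} = B^{q−3} τ^{(3−q)/2}` for `B ≥ 0`, `τ > 0`. [folklore] -/
theorem div_sqrt_rpow_eq {B τ q : ℝ} (hB : 0 ≤ B) (hτ : 0 < τ) :
    (B / Real.sqrt τ) ^ (q - 3) = B ^ (q - 3) * τ ^ ((3 - q) / 2) := by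
  have hsτ : 0 < Real.sqrt τ := Real.sqrt_pos.2 hτ
  rw [Real.div_rpow hB hsτ.le, Real.sqrt_eq_rpow, ← Real.rpow_mul hτ.le, div_eq_mul_inv,
    ← Real.rpow_neg hτ.le]
  congr 2
  ring

/-! ### 2. Along a Type-I blow-up: the Lorentz bound gives every finite Leray rate -/

/-- **Weak-`L³` bound ⟹ weak-`L^q` Leray rate near `T`, `q ≥ 3`**, along a field with the sup-norm
Type-I rate at `T > 0`: if `sup_λ λ³|{λ<‖u(t)‖}| ≤ M'` on `[0,T)` then for some `t₀ < T` and `A`,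
`sup_λ λ^q|{λ<‖u(s)‖}| ≤ A (T−s)^{(3−q)/2}` for `s ∈ [t₀,T)` (interpolation with the ceiling
`‖u(s)‖ ≤ C/√(T−s)`). No equation is used. [folklore] -/
theorem weakLqRate_eventually_of_lorentzBound (hT : 0 < T) (hI : IsTypeIBlowup u T) {M' : ℝ}
    (hM : ∀ t ∈ Ico 0 T, eWeakLpPow (u t) 3 volume ≤ ENNReal.ofReal M') {q : ℝ} (hq : 3 ≤ q) :
    ∃ A t₀ : ℝ, 0 ≤ A ∧ 0 ≤ t₀ ∧ t₀ < T ∧ ∀ s ∈ Ico t₀ T,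
      eWeakLpPow (u s) (ENNReal.ofReal q) volume ≤
        ENNReal.ofReal (A * (T - s) ^ ((3 - q) / 2)) := by
  obtain ⟨CI, hCI⟩ := hI
  obtain ⟨tI, htIT, hIsub⟩ := mem_nhdsLT_iff_exists_Ioo_subset.1 hCI
  have htIT' : tI < T := htIT
  set B : ℝ := max CI 0 + 1 with hB
  have hB0 : 0 < B := by rw [hB]; positivity
  set t₀ : ℝ := max ((tI + T) / 2) 0 with ht₀
  have ht₀T : t₀ < T := max_lt (by linarith) hT
  refine ⟨B ^ (q - 3) * max M' 0, t₀, mul_nonneg (Real.rpow_nonneg hB0.le _) (le_max_right _ _),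
    le_max_right _ _, ht₀T, fun s hs => ?_⟩
  have hs0 : 0 ≤ s := (le_max_right _ _).trans hs.1
  have hstI : tI < s := lt_of_lt_of_le (by linarith : tI < (tI + T) / 2) ((le_max_left _ _).trans hs.1)
  have hτ : 0 < T - s := sub_pos.2 hs.2
  have hsq : 0 < Real.sqrt (T - s) := Real.sqrt_pos.2 hτ
  -- the ceiling at time `s`, with the positive constant `B`
  have hceil : ∀ x, ‖u s x‖ ≤ B / Real.sqrt (T - s) := fun x =>
    (hIsub ⟨hstI, hs.2⟩ x).trans (div_le_div_of_nonneg_right (by rw [hB]; linarith [le_max_left CI 0])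
      hsq.le)
  have hM' : eWeakLpPow (u s) 3 volume ≤ ENNReal.ofReal (max M' 0) :=
    (hM s ⟨hs0, hs.2⟩).trans (ENNReal.ofReal_le_ofReal (le_max_left _ _))
  have h := eWeakLpPow_le_of_norm_le_of_weakL3 (div_pos hB0 hsq) hceil hM' hq
  rw [div_sqrt_rpow_eq hB0.le hτ] at h
  calc eWeakLpPow (u s) (ENNReal.ofReal q) volume
      ≤ ENNReal.ofReal (B ^ (q - 3) * (T - s) ^ ((3 - q) / 2) * max M' 0) := h
    _ = ENNReal.ofReal (B ^ (q - 3) * max M' 0 * (T - s) ^ ((3 - q) / 2)) := by ring_nf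

/-- **Weak-`L³` bound ⟹ weak-`L^q` Leray rate on all of `[0,T)`, `q ≥ 3`**, along a classical solution
on `[0,T)` (`ν, T > 0`), Leray–Hopf from a rapidly decaying datum, with the sup-norm Type-I rate at `T`:
near `T` by `weakLqRate_eventually_of_lorentzBound`; on `[0,t₀]` the solution lies in Tao's class
(`RungReynoldsOne.stub_taoCover`), hence is bounded (Sobolev imbedding), and `(T−s)^{(3−q)/2} ≥ T^{(3−q)/2}`
there. [cite: Tao2011, Thm. 5.4 (i)+(iv)] -/
theorem weakLqRate_of_lorentzBound (hν : 0 < ν) (hT : 0 < T)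
    (hsol : IsClassicalNSSolutionOn (Ico 0 T) ν 0 u p) (hLH : IsLerayHopfOn T ν 0 (u 0) u)
    (hdec : HasRapidSpatialDecay (u 0)) (hI : IsTypeIBlowup u T) {M' : ℝ}
    (hM : ∀ t ∈ Ico 0 T, eWeakLpPow (u t) 3 volume ≤ ENNReal.ofReal M') {q : ℝ} (hq : 3 ≤ q) :
    ∃ A : ℝ, ∀ s ∈ Ico 0 T,
      eWeakLpPow (u s) (ENNReal.ofReal q) volume ≤
        ENNReal.ofReal (A * (T - s) ^ ((3 - q) / 2)) := by
  obtain ⟨A, t₀, hA0, ht₀0, ht₀T, hA⟩ := weakLqRate_eventually_of_lorentzBound hT hI hM hq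
  rcases ht₀0.eq_or_lt with ht₀ | ht₀
  · exact ⟨A, fun s hs => hA s ⟨ht₀.symm.le.trans hs.1, hs.2⟩⟩
  -- `0 < t₀ < T`: Tao's class on `[0, t₀]`
  obtain ⟨q', hsolq, hBq, -, -⟩ := RungReynoldsOne.stub_taoCover hν hT hsol hLH hdec ⟨ht₀, ht₀T⟩
  obtain ⟨B, hB0, hB⟩ := exists_forall_norm_le_of_hasBoundedSobolevNormsOn hsolq hBq
  have hB1 : 0 < B + 1 := by linarith
  -- the early constant
  set A₁ : ℝ := (B + 1) ^ (q - 3) * max M' 0 / T ^ ((3 - q) / 2) with hA₁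
  have hTpow : 0 < T ^ ((3 - q) / 2) := Real.rpow_pos_of_pos hT _
  have hA₁0 : 0 ≤ A₁ :=
    div_nonneg (mul_nonneg (Real.rpow_nonneg hB1.le _) (le_max_right _ _)) hTpow.le
  refine ⟨max A A₁, fun s hs => ?_⟩
  have hτ : 0 < T - s := sub_pos.2 hs.2
  rcases lt_or_ge s t₀ with hst₀ | hst₀
  · -- early time: bounded slice
    have hsI : s ∈ Icc 0 t₀ := ⟨hs.1, hst₀.le⟩
    have hceil : ∀ x, ‖u s x‖ ≤ B + 1 := fun x => (hB s hsI x).trans (by linarith)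
    have hM' : eWeakLpPow (u s) 3 volume ≤ ENNReal.ofReal (max M' 0) :=
      (hM s hs).trans (ENNReal.ofReal_le_ofReal (le_max_left _ _))
    refine (eWeakLpPow_le_of_norm_le_of_weakL3 hB1 hceil hM' hq).trans (ENNReal.ofReal_le_ofReal ?_)
    -- `(B+1)^{q-3} M'⁺ = A₁ T^{(3-q)/2} ≤ A₁ (T-s)^{(3-q)/2} ≤ (max A A₁) (T-s)^{(3-q)/2}`
    have hmono : T ^ ((3 - q) / 2) ≤ (T - s) ^ ((3 - q) / 2) :=
      Real.rpow_le_rpow_of_nonpos hτ (by linarith [hs.1]) (by linarith)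
    calc (B + 1) ^ (q - 3) * max M' 0 = A₁ * T ^ ((3 - q) / 2) := by
          rw [hA₁, div_mul_cancel₀ _ hTpow.ne']
      _ ≤ A₁ * (T - s) ^ ((3 - q) / 2) := mul_le_mul_of_nonneg_left hmono hA₁0
      _ ≤ max A A₁ * (T - s) ^ ((3 - q) / 2) :=
          mul_le_mul_of_nonneg_right (le_max_right _ _) (Real.rpow_nonneg hτ.le _)
  · exact (hA s ⟨hst₀, hs.2⟩).trans (ENNReal.ofReal_le_ofReal
      (mul_le_mul_of_nonneg_right (le_max_left _ _) (Real.rpow_nonneg hτ.le _)))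

/-! ### 3. Per blow-up: every finite rung `q ≥ 3` of Leray's scale is the crux -/

/-- **Per Type-I blow-up, `q ∈ [3,∞)`: weak-`L^q` Leray rate ⟺ uniform weak-`L³` bound.** [folklore] -/
theorem weakLqRate_iff_lorentzBound (hν : 0 < ν) (hT : 0 < T)
    (hmax : IsMaximalSmoothSolution ν 0 u p T) (hLH : IsLerayHopfOn T ν 0 (u 0) u)
    (hdec : HasRapidSpatialDecay (u 0)) (hI : IsTypeIBlowup u T) {q : ℝ} (hq : 3 ≤ q) :
    (∃ A : ℝ, ∀ s ∈ Ico 0 T, eWeakLpPow (u s) (ENNReal.ofReal q) volume ≤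
        ENNReal.ofReal (A * (T - s) ^ ((3 - q) / 2))) ↔
      ∃ M' : ℝ, ∀ t ∈ Ico 0 T, eWeakLpPow (u t) 3 volume ≤ ENNReal.ofReal M' :=
  ⟨fun ⟨_A, hA⟩ => lorentzBound_of_weakLqRate hν hT hmax hLH hdec hI (by linarith) hA,
    fun ⟨_M', hM⟩ => weakLqRate_of_lorentzBound hν hT hmax.1 hLH hdec hI hM hq⟩

/-- **Per Type-I blow-up, `q ∈ [3,∞)`: weak-`L^q` Leray rate ⟺ Leray's quarter rate
`∫‖curl u(t)‖² ≤ K/√(T−t)` on `[0,T)`.** [folklore] -/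
theorem weakLqRate_iff_quarterLaw (hν : 0 < ν) (hT : 0 < T)
    (hmax : IsMaximalSmoothSolution ν 0 u p T) (hLH : IsLerayHopfOn T ν 0 (u 0) u)
    (hdec : HasRapidSpatialDecay (u 0)) (hI : IsTypeIBlowup u T) {q : ℝ} (hq : 3 ≤ q) :
    (∃ A : ℝ, ∀ s ∈ Ico 0 T, eWeakLpPow (u s) (ENNReal.ofReal q) volume ≤
        ENNReal.ofReal (A * (T - s) ^ ((3 - q) / 2))) ↔
      ∃ K : ℝ, ∀ t ∈ Ico 0 T,
        ∫⁻ x, ‖curl (u t) x‖ₑ ^ 2 ≤ ENNReal.ofReal (K / Real.sqrt (T - t)) := by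
  rw [weakLqRate_iff_lorentzBound hν hT hmax hLH hdec hI hq]
  exact ((LorentzOfEnvelope.typeI_slice_tfae (c₀ := 1 / 2) (by norm_num) (by norm_num) hν hT hmax
    hLH hdec hI).out 1 0 :)

/-! ### 4. By name -/

/-- **`QuarterLawTypeI` (stmt-23726) ⟺ «every Type-I blow-up of the class saturates Leray's weak-`L^q`
rate», for each fixed `q ∈ [3,∞)`.** The hypothesis `IsTypeIBlowup` of the crux is saturation at
`q = ∞`; the crux is the passage `∞ ↝ q`. [cite: Leray1934, §21 (3.15)–(3.16)] -/
theorem quarterLawTypeI_iff_weakLqRateTypeI {q : ℝ} (hq : 3 ≤ q) :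
    QuarterLawTypeI ↔
      ∀ (ν T : ℝ), 0 < ν → 0 < T → ∀ (u : ℝ → EuclideanSpace ℝ (Fin 3) → EuclideanSpace ℝ (Fin 3))
        (p : ℝ → EuclideanSpace ℝ (Fin 3) → ℝ),
        IsMaximalSmoothSolution ν 0 u p T → IsLerayHopfOn T ν 0 (u 0) u →
        HasRapidSpatialDecay (u 0) → IsTypeIBlowup u T →
        ∃ A : ℝ, ∀ s ∈ Ico 0 T, eWeakLpPow (u s) (ENNReal.ofReal q) volume ≤
          ENNReal.ofReal (A * (T - s) ^ ((3 - q) / 2)) := by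
  constructor
  · intro h ν T hν hT u p hmax hLH hdec hI
    exact (weakLqRate_iff_quarterLaw hν hT hmax hLH hdec hI hq).2 (h ν T hν hT u p hmax hLH hdec hI)
  · intro h ν T hν hT u p hmax hLH hdec hI
    exact (weakLqRate_iff_quarterLaw hν hT hmax hLH hdec hI hq).1 (h ν T hν hT u p hmax hLH hdec hI)

/-- **`LorentzUpgradeTypeI` (stmt-24108, the open stub `stub_lorentzUpgrade`) ⟺ «every Type-I blow-up
of the class saturates Leray's weak-`L^q` rate», for each fixed `q ∈ [3,∞)`** (`q = 3` is the
statement itself). [folklore] -/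
theorem lorentzUpgradeTypeI_iff_weakLqRateTypeI {q : ℝ} (hq : 3 ≤ q) :
    LorentzUpgradeTypeI ↔
      ∀ (ν T : ℝ), 0 < ν → 0 < T → ∀ (u : ℝ → EuclideanSpace ℝ (Fin 3) → EuclideanSpace ℝ (Fin 3))
        (p : ℝ → EuclideanSpace ℝ (Fin 3) → ℝ),
        IsMaximalSmoothSolution ν 0 u p T → IsLerayHopfOn T ν 0 (u 0) u →
        HasRapidSpatialDecay (u 0) → IsTypeIBlowup u T →
        ∃ A : ℝ, ∀ s ∈ Ico 0 T, eWeakLpPow (u s) (ENNReal.ofReal q) volume ≤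
          ENNReal.ofReal (A * (T - s) ^ ((3 - q) / 2)) := by
  constructor
  · intro h ν T hν hT u p hmax hLH hdec hI
    exact (weakLqRate_iff_lorentzBound hν hT hmax hLH hdec hI hq).2 (h ν T hν hT u p hmax hLH hdec hI)
  · intro h ν T hν hT u p hmax hLH hdec hI
    exact (weakLqRate_iff_lorentzBound hν hT hmax hLH hdec hI hq).1 (h ν T hν hT u p hmax hLH hdec hI)

/-! ### 5. Eventual forms: the Leray rate near `T` suffices -/

/-- **A bounded finite-energy slice has every weak-`L^q` quasinorm finite, `q ≥ 3`:** `‖v‖ ≤ B`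
(`B > 0`) and `∫‖v‖² ≤ E` give `sup_λ λ^q|{λ<‖v‖}| ≤ B^{q−3}(B E)` (the tree's
`LorentzOfEnvelope.eWeakLpPow_three_le_of_norm_le`, then `eWeakLpPow_le_of_norm_le_of_weakL3`). [folklore] -/
theorem eWeakLpPow_le_of_norm_le_of_energy
    {v : EuclideanSpace ℝ (Fin 3) → EuclideanSpace ℝ (Fin 3)} (hv : AEStronglyMeasurable v volume)
    {B E q : ℝ} (hB0 : 0 < B) (hB : ∀ x, ‖v x‖ ≤ B) (hE : ∫⁻ x, ‖v x‖ₑ ^ 2 ≤ ENNReal.ofReal E)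
    (hq : 3 ≤ q) :
    eWeakLpPow v (ENNReal.ofReal q) volume ≤ ENNReal.ofReal (B ^ (q - 3) * (B * E)) :=
  eWeakLpPow_le_of_norm_le_of_weakL3 hB0 hB
    (LorentzOfEnvelope.eWeakLpPow_three_le_of_norm_le hv hB hE) hq

/-- **Eventual ⟹ global for the weak-`L^q` Leray rate, `q ≥ 3`**, along a classical solution on
`[0,T)` (`ν, T > 0`), Leray–Hopf from a rapidly decaying datum: if
`sup_λ λ^q|{λ<‖u(s)‖}| ≤ A(T−s)^{(3−q)/2}` on `[t₀,T)` for some `t₀ < T`, then, with another constant,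
on all of `[0,T)` — on `[0,t₀]` the solution lies in Tao's class (`RungReynoldsOne.stub_taoCover`),
hence is bounded (Sobolev imbedding), with energy `≤ E(u₀)`. [cite: Tao2011, Thm. 5.4 (i)+(iv)] -/
theorem weakLqRate_of_eventually (hν : 0 < ν) (hT : 0 < T)
    (hsol : IsClassicalNSSolutionOn (Ico 0 T) ν 0 u p) (hLH : IsLerayHopfOn T ν 0 (u 0) u)
    (hdec : HasRapidSpatialDecay (u 0)) {q : ℝ} (hq : 3 ≤ q)
    (hev : ∃ A t₀ : ℝ, t₀ < T ∧ ∀ s ∈ Ico t₀ T, eWeakLpPow (u s) (ENNReal.ofReal q) volume ≤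
      ENNReal.ofReal (A * (T - s) ^ ((3 - q) / 2))) :
    ∃ A : ℝ, ∀ s ∈ Ico 0 T, eWeakLpPow (u s) (ENNReal.ofReal q) volume ≤
      ENNReal.ofReal (A * (T - s) ^ ((3 - q) / 2)) := by
  obtain ⟨A, t₀, ht₀T, hA⟩ := hev
  rcases le_or_gt t₀ 0 with ht₀ | ht₀
  · exact ⟨A, fun s hs => hA s ⟨ht₀.trans hs.1, hs.2⟩⟩
  -- `0 < t₀ < T`: Tao's class on `[0, t₀]`
  obtain ⟨q', hsolq, hBq, -, -⟩ := RungReynoldsOne.stub_taoCover hν hT hsol hLH hdec ⟨ht₀, ht₀T⟩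
  obtain ⟨B, hB0, hB⟩ := exists_forall_norm_le_of_hasBoundedSobolevNormsOn hsolq hBq
  have hB1 : 0 < B + 1 := by linarith
  set E : ℝ := 2 * VectorCalculus.kineticEnergy (u 0) with hE_def
  have hE0 : 0 ≤ E := by
    rw [hE_def]; exact mul_nonneg zero_le_two (kineticEnergy_nonneg (u 0))
  set A₁ : ℝ := (B + 1) ^ (q - 3) * ((B + 1) * E) / T ^ ((3 - q) / 2) with hA₁
  have hTpow : 0 < T ^ ((3 - q) / 2) := Real.rpow_pos_of_pos hT _
  have hA₁0 : 0 ≤ A₁ :=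
    div_nonneg (mul_nonneg (Real.rpow_nonneg hB1.le _) (mul_nonneg hB1.le hE0)) hTpow.le
  refine ⟨max A A₁, fun s hs => ?_⟩
  have hτ : 0 < T - s := sub_pos.2 hs.2
  rcases lt_or_ge s t₀ with hst₀ | hst₀
  · -- early time: bounded slice with energy `≤ E`
    have hsI : s ∈ Icc 0 t₀ := ⟨hs.1, hst₀.le⟩
    have hceil : ∀ x, ‖u s x‖ ≤ B + 1 := fun x => (hB s hsI x).trans (by linarith)
    have hmem : MemLp (u s) 2 volume := hLH.memLp s ⟨hs.1, hs.2.le⟩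
    have hen : ∫⁻ x, ‖u s x‖ₑ ^ 2 ≤ ENNReal.ofReal E :=
      LorentzOfEnvelope.lintegral_sq_le_of_isLerayHopfOn hν.le hLH ⟨hs.1, hs.2.le⟩
    refine (eWeakLpPow_le_of_norm_le_of_energy hmem.1 hB1 hceil hen hq).trans
      (ENNReal.ofReal_le_ofReal ?_)
    have hmono : T ^ ((3 - q) / 2) ≤ (T - s) ^ ((3 - q) / 2) :=
      Real.rpow_le_rpow_of_nonpos hτ (by linarith [hs.1]) (by linarith)
    calc (B + 1) ^ (q - 3) * ((B + 1) * E) = A₁ * T ^ ((3 - q) / 2) := by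
          rw [hA₁, div_mul_cancel₀ _ hTpow.ne']
      _ ≤ A₁ * (T - s) ^ ((3 - q) / 2) := mul_le_mul_of_nonneg_left hmono hA₁0
      _ ≤ max A A₁ * (T - s) ^ ((3 - q) / 2) :=
          mul_le_mul_of_nonneg_right (le_max_right _ _) (Real.rpow_nonneg hτ.le _)
  · exact (hA s ⟨hst₀, hs.2⟩).trans (ENNReal.ofReal_le_ofReal
      (mul_le_mul_of_nonneg_right (le_max_left _ _) (Real.rpow_nonneg hτ.le _)))

/-- **Per blow-up: the weak-`L^q` Leray rate is its own eventual form, `q ≥ 3`.** [folklore] -/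
theorem weakLqRate_iff_eventually (hν : 0 < ν) (hT : 0 < T)
    (hsol : IsClassicalNSSolutionOn (Ico 0 T) ν 0 u p) (hLH : IsLerayHopfOn T ν 0 (u 0) u)
    (hdec : HasRapidSpatialDecay (u 0)) {q : ℝ} (hq : 3 ≤ q) :
    (∃ A : ℝ, ∀ s ∈ Ico 0 T, eWeakLpPow (u s) (ENNReal.ofReal q) volume ≤
        ENNReal.ofReal (A * (T - s) ^ ((3 - q) / 2))) ↔
      ∃ A t₀ : ℝ, t₀ < T ∧ ∀ s ∈ Ico t₀ T, eWeakLpPow (u s) (ENNReal.ofReal q) volume ≤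
        ENNReal.ofReal (A * (T - s) ^ ((3 - q) / 2)) :=
  ⟨fun ⟨A, h⟩ => ⟨A, 0, hT, h⟩, weakLqRate_of_eventually hν hT hsol hLH hdec hq⟩

/-- **By name: `LorentzUpgradeTypeI` (stmt-24108, the open stub `stub_lorentzUpgrade`) follows from the
EVENTUAL saturation of Leray's weak-`L^q` rate at one finite `q ≥ 3`** — if every Type-I blow-up of the
class obeys `sup_λ λ^q|{λ<‖u(s)‖}| ≤ A(T−s)^{(3−q)/2}` for `s` near `T`. [folklore] -/
theorem lorentzUpgradeTypeI_of_eventualWeakLqRate {q : ℝ} (hq : 3 ≤ q)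
    (h : ∀ (ν T : ℝ), 0 < ν → 0 < T →
      ∀ (u : ℝ → EuclideanSpace ℝ (Fin 3) → EuclideanSpace ℝ (Fin 3))
        (p : ℝ → EuclideanSpace ℝ (Fin 3) → ℝ),
        IsMaximalSmoothSolution ν 0 u p T → IsLerayHopfOn T ν 0 (u 0) u →
        HasRapidSpatialDecay (u 0) → IsTypeIBlowup u T →
        ∃ A t₀ : ℝ, t₀ < T ∧ ∀ s ∈ Ico t₀ T, eWeakLpPow (u s) (ENNReal.ofReal q) volume ≤
          ENNReal.ofReal (A * (T - s) ^ ((3 - q) / 2))) :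
    LorentzUpgradeTypeI := by
  intro ν T hν hT u p hmax hLH hdec hI
  obtain ⟨A, hA⟩ := weakLqRate_of_eventually hν hT hmax.1 hLH hdec hq (h ν T hν hT u p hmax hLH hdec hI)
  exact lorentzBound_of_weakLqRate hν hT hmax hLH hdec hI (by linarith) hA

/-- **By name: `QuarterLawTypeI` (stmt-23726) follows from the EVENTUAL saturation of Leray's
weak-`L^q` rate at one finite `q ≥ 3` along every Type-I blow-up of the class.** [folklore] -/
theorem quarterLawTypeI_of_eventualWeakLqRate {q : ℝ} (hq : 3 ≤ q)
    (h : ∀ (ν T : ℝ), 0 < ν → 0 < T →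
      ∀ (u : ℝ → EuclideanSpace ℝ (Fin 3) → EuclideanSpace ℝ (Fin 3))
        (p : ℝ → EuclideanSpace ℝ (Fin 3) → ℝ),
        IsMaximalSmoothSolution ν 0 u p T → IsLerayHopfOn T ν 0 (u 0) u →
        HasRapidSpatialDecay (u 0) → IsTypeIBlowup u T →
        ∃ A t₀ : ℝ, t₀ < T ∧ ∀ s ∈ Ico t₀ T, eWeakLpPow (u s) (ENNReal.ofReal q) volume ≤
          ENNReal.ofReal (A * (T - s) ^ ((3 - q) / 2))) :
    QuarterLawTypeI := by
  intro ν T hν hT u p hmax hLH hdec hI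
  obtain ⟨A, hA⟩ := weakLqRate_of_eventually hν hT hmax.1 hLH hdec hq (h ν T hν hT u p hmax hLH hdec hI)
  exact quarterLaw_of_weakLqRate hν hT hmax hLH hdec hI (by linarith) hA

end LerayLqClass

end Summit.NavierStokesRegularity.NavierStokesRegularity.Theorems

end
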